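import Literature.NumberTheory.EllipticCurves.EisensteinNewformLevelRaisingInertiaProofs
import Literature.NumberTheory.EllipticCurves.EisensteinNewformLevelRaisingProofs
import Literature.NumberTheory.Automorphic.HilbertModularLocalGlobal
import Literature.NumberTheory.Automorphic.GLnAdelicStructureProofs
import HarnessLib

/-!
# Hida 2000, Thm. 3.26 (3)(a) — Part H: reduction to the tree's local–global compatibility fact
# `Automorphic.galoisRep_GL2_totallyReal_localGlobal` (Carayol 1986, Thm. (A))

Topic `Literature/NumberTheory/EllipticCurves`; sibling proof file of
`EisensteinNewformLevelRaising` (the named fact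
`Literature.NumberTheory.EllipticCurves.Hida2000_thm326_inertia_of_level`) and of
`EisensteinNewformLevelRaisingInertiaProofs` (Parts A–G, the Galois-side sockets).  THEOREMS ONLY
(no definition, no named fact; D-0026).

Hida (*Modular Forms and Galois Cohomology* (2000), Thm. 3.26 (3), p. 152; p. 153: "we will take
for granted this theorem, whose proof is a little outside the scope of this book") attributes (3)
to Langlands [L] (= Langlands 1973, LNM 349, Thm. 7.1, principal series) and Carayol [C1]
(= Carayol 1986, Thm. (A): `σ_λ|_{W_𝔭} ≅ σ(π_𝔭)` at EVERY finite `𝔭 ∤ λ`).  Since 2026-08-16 the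
tree carries Carayol's theorem as the named fact
`Literature.NumberTheory.Automorphic.galoisRep_GL2_totallyReal_localGlobal`
(`Automorphic/HilbertModularLocalGlobal.lean`: `GL₂` over totally real `K`, every finite place,
Buzzard–Gee's L-normalisation, an abstract local Langlands datum `llc v` bound under `∀ K`).  This
file proves what the tree can prove of the road from that fact to Hida's (3)(a):

* **H0. Determinants through the Grothendieck–Deligne recipe and along `ι`.**
  `det_one_add_eq_one_of_isNilpotent`, `det_exp_eq_one_of_isNilpotent` (`det exp P = 1` for
  nilpotent `P`, via Mathlib's `Matrix.isUnit_charpolyRev_of_isNilpotent`),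
  `IsWeilDeligneOfLadic.det_eq_of_mem_inertia` (`det ρW(u) = det ρ_WD(u)` on inertia — the
  companion of the tree's `IsWeilDeligneOfLadic.trace_eq_of_mem_inertia`),
  `det_eq_of_isTransportAlong`.
* **H1. Newform Galois representations are automorphic (a.e.).**  From the tree's PROVED
  `Gelbart1975_exists_cuspidalRepData_LAlgebraic_holds` (Gelbart 1975, Thm. 5.19, L-normalised):
  `exists_cuspidalRepData_satakeFrobCompatibleAE` — for a newform `g ∈ S_k(Γ₁(N))`, `k ≥ 2`, and ANY
  `ρ` attached to `g` away from `Np`, Gelbart's cuspidal `π` (weight-`k` infinity type, Satake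
  parameters of `g` at `ℓ ∤ N`) satisfies `SatakeFrobCompatibleAE ι π.1 ρ`; hence
  `isAutomorphicAE_of_isGaloisRepOfNewform1 : IsAutomorphicAE ι hcpt ρ` (Buzzard–Gee 2014, §3.1).
  These are exactly the automorphic hypotheses of `galoisRep_GL2_totallyReal_localGlobal`.
* **H2. The reduction.**  `inertia_of_level_of_localGlobal`: `galoisRep_GL2_totallyReal_localGlobal`
  together with ONE purely local-automorphic statement `hrec` implies
  `Hida2000_thm326_inertia_of_level`.  `hrec` says: for every local Langlands datum `d` of `ℚ_ℓ`
  (the fact's `llc` is abstract, so the statement is made for all data; it is `d`-invariant) and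
  every Frobenius-semisimple representative `W` of the class `d.recGL 2 ⟦π_ℓ⟧` of the local
  component `π_ℓ` at `ℓ ∣ N`, `v_ℓ(N) = v_ℓ(cond χ)`, of a cuspidal `π` of `GL₂(𝔸_ℚ)` with the
  newform's weight-`k` infinity type and Satake parameters at all `ℓ' ∤ N`:
  `tr W(u) = 1 + det W(u)` for `u` in the inertia group — i.e. `rec(π_ℓ)|_{I_ℓ}` contains the
  trivial character.  This is the conjunction of two published inputs the tree does not yet carry:
  (a) the local component of the newform's representation at such `ℓ` is the principal series
  `π(μ₁, μ₂)` with `μ₁` unramified (Casselman 1973, Thm. 1; Gelbart 1975, §5; Loeffler–Weinstein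
  2012, §2), after strong multiplicity one; (b) every local Langlands correspondence (clauses
  (i)–(v) of `IsLocalLanglandsGL`, in particular (iii-L) with the `GL₂ × GL₁` zeta integrals of
  Jacquet–Langlands 1970, Prop. 3.5) sends an irreducible principal series `π(μ₁, μ₂)` to
  `μ₁ ∘ art_d ⊕ μ₂ ∘ art_d` with `N = 0` (Bushnell–Henniart 2006, §33).  Given `hrec`, the proof
  is: H1 ⇒ the fact applies to `(ℚ, π, p, ι, ρ)`; at the place `w ∣ ℓ` it yields `π_w`, the
  Weil–Deligne representation `r_w` of `ρ|_{Γ_{ℚ_w}}` (Grothendieck–Deligne, `ℓ ≠ p`), its transport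
  `ι(r_w)` and `ι(r_w)^{F-ss} ∈ (llc w).recGL 2 ⟦π_w⟧`; `hrec` gives `tr = 1 + det` on inertia for
  the Frobenius-semisimplification, which has the same restriction to inertia
  (`IsFrobSemisimplificationOf`); H0 and `IsWeilDeligneOfLadic.trace_eq_of_mem_inertia` move the
  identity back along `ι` and through the recipe to `ρ|_{Γ_{ℚ_w}}` on `absInertia`
  (`WeilGroup.inertia_map_toAbsGalois`); Part F's socket
  `inertia_shape_of_local_trace_eq_one_add_det` (Parts A–E: `det ρ = ι⁻¹χ(χ_N)` on `I_𝔔`,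
  `χ ∘ χ_N ≠ 1` there, the `ℓ ≠ p` unipotent trick and the `2 × 2` diagonalisation) concludes.

So `Hida2000_thm326_inertia_of_level` is CLOSED MODULO
{`galoisRep_GL2_totallyReal_localGlobal` (existing named fact, Carayol 1986 Thm. (A)), `hrec`
(inputs (a)–(b) above, not yet in `Literature/`)}; the alternative one-step road of Part G
(`inertia_of_level_of_finrank_inertiaInvariants`, Carayol (A) read on inertia invariants) is
unchanged.

## References

* H. Hida, *Modular Forms and Galois Cohomology*, CUP (2000), Thm. 3.26 (3)(a), pp. 152–153. [Hida2000]
* H. Carayol, Ann. Sci. ÉNS 19 (1986) 409–468, Thm. (A). [CarayolASENS1986]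
* R. P. Langlands, *Modular forms and ℓ-adic representations*, LNM 349 (1973), Thm. 7.1. [Langlands1973]
* C. Skinner, Doc. Math. 14 (2009) 241–258, (1) p. 242. [Skinner2009]
* S. Gelbart, *Automorphic forms on adele groups*, Ann. of Math. Stud. 83 (1975), Thm. 5.19. [Gelbart1975]
* K. Buzzard, T. Gee, LMS Lecture Note Ser. 414 (2014), §3.1, Conj. 3.2.1. [BuzzardGeeLMS2014]
* P. Deligne, *Les constantes des équations fonctionnelles des fonctions L*, Antwerp II, LNM 349
  (1973), §8.4–8.6. [DeligneAntwerpII1973]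
-/

noncomputable section

open scoped MatrixGroups Matrix NumberField ModularForm
open Matrix CongruenceSubgroup IsDedekindDomain Field NumberField Polynomial Filter

namespace Literature.NumberTheory.EllipticCurves.Hida2000Thm326

open Literature.NumberTheory.EllipticCurves.ModularForms
open Literature.NumberTheory.GaloisRepresentations Literature.NumberTheory.Automorphic
open Rat.HeightOneSpectrum UpperHalfPlane

/-! ## Part H0. Determinants through the recipe and along `ι` -/

section DetLemmas

variable {K : Type*} [Field K] {n : Type*} [Fintype n] [DecidableEq n]

/-- `det (1 + Q) = 1` for a nilpotent matrix `Q` over a field: the reverse characteristic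
polynomial `det (1 - X Q)` of a nilpotent matrix is a unit of `K[X]` (Mathlib
`Matrix.isUnit_charpolyRev_of_isNilpotent`), hence a constant, equal to its value `1` at `X = 0`;
evaluate at `X = 1`. [folklore] -/
theorem det_one_add_eq_one_of_isNilpotent {Q : Matrix n n K} (hQ : IsNilpotent Q) :
    (1 + Q).det = 1 := by
  have hu : IsUnit (-Q).charpolyRev := Matrix.isUnit_charpolyRev_of_isNilpotent hQ.neg
  obtain ⟨r, -, hC⟩ := Polynomial.isUnit_iff.mp hu
  have h0 : r = 1 := by
    have h := Matrix.eval_charpolyRev (M := -Q)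
    rwa [← hC, eval_C] at h
  have h1 : eval 1 (-Q).charpolyRev = (1 + Q).det := by
    rw [Matrix.charpolyRev, ← coe_evalRingHom, RingHom.map_det]
    congr 1
    ext i j
    by_cases hij : i = j
    · subst hij; simp
    · simp [hij]
  rw [← hC, eval_C, h0] at h1
  exact h1.symm

/-- `det (exp P) = 1` for a nilpotent matrix `P` (characteristic zero): `exp P - 1` is nilpotent
(Mathlib `IsNilpotent.isNilpotent_exp_sub_one`). [folklore] -/
theorem det_exp_eq_one_of_isNilpotent [CharZero K] {P : Matrix n n K} (hP : IsNilpotent P) :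
    (IsNilpotent.exp P).det = 1 := by
  have h : IsNilpotent.exp P = 1 + (IsNilpotent.exp P - 1) := by abel
  rw [h]
  exact det_one_add_eq_one_of_isNilpotent (IsNilpotent.isNilpotent_exp_sub_one hP)

end DetLemmas

/-- **The Weil–Deligne representation has the same inertial determinants as the `ℓ`-adic
representation it comes from**: if `r = (ρ_WD, N)` is attached to `ρW` by the Grothendieck–Deligne
recipe (`IsWeilDeligneOfLadic`), then `det ρW(u) = det ρ_WD(u)` for `u ∈ I_F`, since
`ρ_WD(u) = ρW(u) exp(-t(u) N)` and `det exp(-t(u) N) = 1`.  Companion of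
`IsWeilDeligneOfLadic.trace_eq_of_mem_inertia`.
Ref: Deligne, Antwerp II (1973), §8.4.2; Tate, Corvallis (1979), (4.2.1).
[cite: DeligneAntwerpII1973, §8.4.2] -/
theorem _root_.Literature.NumberTheory.GaloisRepresentations.IsWeilDeligneOfLadic.det_eq_of_mem_inertia
    {F : Type*} [Field F] [ValuativeRel F] [TopologicalSpace F] [IsNonarchimedeanLocalField F]
    {E : Type*} [Field E] [CharZero E] {n : ℕ} {ρW : WeilGroup F →* GL (Fin n) E}
    {r : WeilDeligneRep F E (Fin n → E)} (h : IsWeilDeligneOfLadic ρW r)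
    (u : WeilGroup F) (hu : u ∈ WeilGroup.inertia F) :
    ((ρW u : GL (Fin n) E) : Matrix (Fin n) (Fin n) E).det = (LinearMap.toMatrix' (r.ρ u)).det := by
  classical
  obtain ⟨t, U, Φ, -, -, -, -, -, h3⟩ := h
  set Nm : Matrix (Fin n) (Fin n) E := LinearMap.toMatrix' r.N with hNm
  have hNnil : IsNilpotent Nm := r.isNilpotent_N.map LinearMap.toMatrixAlgEquiv'
  set a : E := (t ⟨u, hu⟩).toAdd with ha
  have hrec : LinearMap.toMatrix' (r.ρ u) =
      ((ρW u : GL (Fin n) E) : Matrix (Fin n) (Fin n) E) * IsNilpotent.exp (-(a • Nm)) := by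
    have h := h3 0 ⟨u, hu⟩
    rwa [zpow_zero, one_mul] at h
  rw [hrec, Matrix.det_mul, det_exp_eq_one_of_isNilpotent (hNnil.smul a).neg, mul_one]

/-- Transport along `ι` commutes with Weil-group determinants: `det Wℂ(w) = ι(det W(w))`
(companion of `trace_eq_of_isTransportAlong`). [folklore] -/
theorem det_eq_of_isTransportAlong {F : Type*} [Field F] [ValuativeRel F] [TopologicalSpace F]
    [IsNonarchimedeanLocalField F] {E : Type*} [Field E] [CharZero E] {C : Type*} [Field C]
    [CharZero C] {n : ℕ} {ι : E →+* C} {W : WeilDeligneRep F E (Fin n → E)}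
    {Wc : WeilDeligneRep F C (Fin n → C)} (hT : W.IsTransportAlong ι Wc) (w : WeilGroup F) :
    LinearMap.det (Wc.ρ w) = ι (LinearMap.det (W.ρ w)) := by
  rw [← LinearMap.det_toMatrix', ← LinearMap.det_toMatrix', hT.1 w, RingHom.map_det,
    RingHom.mapMatrix_apply]

/-! ## Part H1. Newform Galois representations are automorphic (almost everywhere) -/

section Automorphy

variable {N : ℕ} [NeZero N] {k : ℤ}

/-- A `GL₂/ℚ` datum with the weight-`k` infinity type `{(k-1, 0), (0, k-1)}` is L-algebraic, and has
a regular infinity type when `k ≠ 1` — the two automorphic hypotheses of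
`galoisRep_GL2_totallyReal_localGlobal`. Buzzard–Gee 2014, §3.1. [folklore] -/
theorem isLAlgebraic_of_hasInfinityType_weight {hcpt : isCompact_glFiniteIntegralLevel 2 ℚ}
    {π : CuspidalAutomorphicRepData 2 ℚ hcpt} {k : ℤ} (hk : k ≠ 1)
    (hT : π.1.HasInfinityType (fun _ =>
      ({⟨(k : ℂ) - 1, 0, ⟨k - 1, by push_cast; ring⟩⟩, ⟨0, (k : ℂ) - 1, ⟨1 - k, by push_cast; ring⟩⟩} :
        Multiset ArchWeight))) :
    π.1.IsLAlgebraic ∧ ∃ T : InfinityType ℚ 2, π.1.HasInfinityType T ∧ T.IsRegular := by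
  refine ⟨⟨_, hT, ?_⟩, ⟨_, hT, ?_⟩⟩
  · intro σ q hq
    simp only [Multiset.insert_eq_cons, Multiset.mem_cons, Multiset.mem_singleton] at hq
    rcases hq with rfl | rfl
    · exact ⟨k - 1, 0, by push_cast; ring, by simp⟩
    · exact ⟨0, k - 1, by simp, by push_cast; ring⟩
  · intro σ
    simp only [Multiset.insert_eq_cons, Multiset.map_cons, Multiset.map_singleton, Multiset.nodup_cons,
      Multiset.mem_singleton, Multiset.nodup_singleton, and_true]
    have : ((k : ℂ) - 1) ≠ 0 := by
      rw [sub_ne_zero]; exact_mod_cast hk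
    exact this

/-- **Satake–Frobenius compatibility at one place, L-normalisation**: if the inverse roots of a
multiset `α` cut out the Hecke polynomial `X² - a_q X + χ(q) q^{k-1}` of `g`, then
`arithFrobPolyOfSatake ι r 1 α = ι⁻¹(X² - a_q X + χ(q) q^{k-1})`, the Frobenius characteristic
polynomial prescribed by `IsGaloisRepOfNewform1` (coefficient map `ι⁻¹ ∘ (K_g ⊆ ℂ)`).
Buzzard–Gee 2014, §3.1. [cite: BuzzardGeeLMS2014, §3.1] -/
theorem arithFrobPolyOfSatake_eq_map_heckePolynomial (g : CuspForm (Gamma1 N) k) {p : ℕ} [Fact p.Prime]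
    (ι : PadicAlgCl p ≃+* ℂ) (q r : ℕ) {α : Multiset ℂ}
    (hpoly : (α.map fun a => X - C a⁻¹).prod =
      X ^ 2 - C ((qExpansion 1 ⇑g).coeff q) * X + C ((nebentypus g (q : ZMod N) : ℂ) * (q : ℂ) ^ (k - 1))) :
    arithFrobPolyOfSatake ι r 1 α =
      (heckePolynomial g q).map ((ι.symm : ℂ →+* PadicAlgCl p).comp (algebraMap (coeffCharField g) ℂ)) := by
  rw [arithFrobPolyOfSatake_one, ← Polynomial.map_map, map_heckePolynomial, ← hpoly,
    Polynomial.map_multiset_prod, Multiset.map_map]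
  congr 1
  refine Multiset.map_congr rfl fun a _ => ?_
  simp [Polynomial.map_sub, Polynomial.map_X, Polynomial.map_C]

/-- **The cuspidal automorphic representation of a newform, with Satake–Frobenius compatibility
for every Galois representation attached to it** (Gelbart 1975, Thm. 5.19, in Buzzard–Gee's
L-normalisation — the tree's PROVED `Gelbart1975_exists_cuspidalRepData_LAlgebraic_holds`): for
a newform `g ∈ S_k(Γ₁(N))`, `k ≥ 2`, `ι : ℚ̄_p ≃ ℂ` and ANY `ρ : Γ_ℚ → GL₂(ℚ̄_p)` attached to `g`
away from `Np` (`IsGaloisRepOfNewform1`), there is a cuspidal datum `π` of `GL₂(𝔸_ℚ)` with the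
weight-`k` infinity type `{(k-1, 0), (0, k-1)}`, the Satake parameters of `g` at every `ℓ ∤ N`
(inverse roots = Hecke polynomial), and `ρ` attached to `π` at almost all places
(`SatakeFrobCompatibleAE ι π.1 ρ`: at every `v ∤ Np`).
[cite: Gelbart1975, Thm. 5.19 and Lemma 5.16, pp. 60–62] [cite: BuzzardGeeLMS2014, §3.1, Conj. 3.2.1] -/
theorem exists_cuspidalRepData_satakeFrobCompatibleAE (g : CuspForm (Gamma1 N) k) (hk : 2 ≤ k)
    (hg : IsNewform1 g) (p : ℕ) [Fact p.Prime] (ι : PadicAlgCl p ≃+* ℂ)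
    (ρ : FramedGaloisRep ℚ (PadicAlgCl p) 2)
    (hρ : IsGaloisRepOfNewform1 g
      ((ι.symm : ℂ →+* PadicAlgCl p).comp (algebraMap (coeffCharField g) ℂ)) {q | q ∣ N * p} ρ)
    (hcpt : isCompact_glFiniteIntegralLevel 2 ℚ) :
    ∃ π : CuspidalAutomorphicRepData 2 ℚ hcpt,
      π.1.HasInfinityType (fun _ =>
        ({⟨(k : ℂ) - 1, 0, ⟨k - 1, by push_cast; ring⟩⟩, ⟨0, (k : ℂ) - 1, ⟨1 - k, by push_cast; ring⟩⟩} :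
          Multiset ArchWeight)) ∧
      (∀ ℓ : ℕ, ℓ.Prime → ¬ ℓ ∣ N →
        ∀ w : HeightOneSpectrum (𝓞 ℚ), (ℓ : 𝓞 ℚ) ∈ w.asIdeal →
          ∃ α : Multiset ℂ, π.1.HasSatakeParamAt w α ∧
            (α.map fun a => X - C a⁻¹).prod =
              X ^ 2 - C ((qExpansion 1 ⇑g).coeff ℓ) * X +
                C ((nebentypus g (ℓ : ZMod N) : ℂ) * (ℓ : ℂ) ^ (k - 1))) ∧
      SatakeFrobCompatibleAE ι π.1 ρ := by
  classical
  obtain ⟨π, hT, hSat⟩ := Gelbart1975_exists_cuspidalRepData_LAlgebraic_holds g hk hg hcpt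
  refine ⟨π, hT, hSat, ?_⟩
  have hp : (p : ℕ).Prime := Fact.out
  -- the finite exceptional set of places
  set S : Set (HeightOneSpectrum (𝓞 ℚ)) := {v | ((primesEquiv v : Nat.Primes) : ℕ) ∣ N * p}
    with hSdef
  have hS : S.Finite := by
    have hfin : {n : ℕ | n ∣ N * p}.Finite :=
      (N * p).divisors.finite_toSet.subset fun n hn ↦
        Nat.mem_divisors.mpr ⟨hn, mul_ne_zero (NeZero.ne N) hp.ne_zero⟩
    refine (hfin.preimage (f := fun v : HeightOneSpectrum (𝓞 ℚ) ↦ ((primesEquiv v : Nat.Primes) : ℕ))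
      fun v _ w _ h ↦ primesEquiv.injective (Subtype.ext h)).subset ?_
    intro v hv
    exact hv
  refine Filter.eventually_cofinite.mpr (hS.subset fun v hv => ?_)
  by_contra hvS
  apply hv
  set q : ℕ := ((primesEquiv v : Nat.Primes) : ℕ) with hqdef
  have hq : q.Prime := (primesEquiv v).2
  have hqNp : ¬ q ∣ N * p := hvS
  have hqN : ¬ q ∣ N := fun h ↦ hqNp (h.mul_right p)
  have hqv : (q : 𝓞 ℚ) ∈ v.asIdeal := by
    rw [Rat.natCast_mem_asIdeal_iff]
    exact dvd_rfl
  obtain ⟨α, hα, hpoly⟩ := hSat q hq hqN v hqv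
  obtain ⟨hunr, hfrob⟩ := hρ v hqNp
  refine ⟨α, hα, hunr, ?_⟩
  rw [arithFrobPolyOfSatake_eq_map_heckePolynomial g ι q v.residueCard hpoly]
  exact hfrob

/-- **Galois representations attached to classical newforms of weight `k ≥ 2` are automorphic**
(almost-everywhere association in Buzzard–Gee's L-normalisation): `IsAutomorphicAE ι hcpt ρ` for
every `ρ : Γ_ℚ → GL₂(ℚ̄_p)` attached to a newform `g ∈ S_k(Γ₁(N))` away from `Np` — the
L-algebraic cuspidal `π` is Gelbart's (`exists_cuspidalRepData_satakeFrobCompatibleAE`).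
[cite: Gelbart1975, Thm. 5.19] [cite: BuzzardGeeLMS2014, §3.1, Conj. 3.2.1] -/
theorem isAutomorphicAE_of_isGaloisRepOfNewform1 (g : CuspForm (Gamma1 N) k) (hk : 2 ≤ k)
    (hg : IsNewform1 g) (p : ℕ) [Fact p.Prime] (ι : PadicAlgCl p ≃+* ℂ)
    (ρ : FramedGaloisRep ℚ (PadicAlgCl p) 2)
    (hρ : IsGaloisRepOfNewform1 g
      ((ι.symm : ℂ →+* PadicAlgCl p).comp (algebraMap (coeffCharField g) ℂ)) {q | q ∣ N * p} ρ)
    (hcpt : isCompact_glFiniteIntegralLevel 2 ℚ) :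
    IsAutomorphicAE ι hcpt ρ := by
  obtain ⟨π, hT, -, hAE⟩ := exists_cuspidalRepData_satakeFrobCompatibleAE g hk hg p ι ρ hρ hcpt
  exact ⟨π, (isLAlgebraic_of_hasInfinityType_weight (by omega) hT).1, hAE⟩

end Automorphy

/-! ## Part H2. The reduction to `galoisRep_GL2_totallyReal_localGlobal` -/

section LocalGlobal

open scoped Valued
open ValuativeRel

/-- **Hida 2000, Thm. 3.26 (3)(a) from Carayol's local–global compatibility, as carried by the
tree, plus the local shape of the newform's component at `ℓ`.**  Hypotheses:
`hX` — the named fact `Automorphic.galoisRep_GL2_totallyReal_localGlobal` (Carayol 1986, Thm. (A);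
Skinner 2009, (1));
`hrec` — for every newform `g ∈ S_k(Γ₁(N))` (`k ≥ 2`), every cuspidal datum `π` of `GL₂(𝔸_ℚ)` with
the weight-`k` infinity type and the Satake parameters of `g` at all `ℓ' ∤ N`, every prime `ℓ ∣ N`
with `v_ℓ(N) = v_ℓ(cond χ)`, `w ∣ ℓ`, every local Langlands datum `d` of `ℚ_w`, every local
component `π_w` of `π` at `w` and every Frobenius-semisimple `W` in the class `d.recGL 2 ⟦π_w⟧`:
`tr W(u) = 1 + det W(u)` on the inertia group of `W_{ℚ_w}` (the local component is
`π(μ₁, μ₂)` with `μ₁` unramified — Casselman 1973, Thm. 1; Gelbart 1975, §5 — and every local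
Langlands correspondence sends it to `μ₁ ∘ art ⊕ μ₂ ∘ art`, `N = 0` — Bushnell–Henniart 2006, §33;
a `d`-invariant reading of Carayol's (A) on `L`-factor degrees, NOT yet a theorem or fact of the
tree).  Conclusion: the named fact `Hida2000_thm326_inertia_of_level`.
Proof: H1 (`exists_cuspidalRepData_satakeFrobCompatibleAE`) feeds `hX` at `(ℚ, π, p, ι, ρ)`; at
`w ∣ ℓ ≠ p` the fact gives `π_w`, `r_w = WD(ρ|_{Γ_{ℚ_w}})`, `ι(r_w)` and
`ι(r_w)^{F-ss} ∈ (llc w).recGL 2 ⟦π_w⟧`; `hrec` and `IsFrobSemisimplificationOf` (same restriction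
to inertia) give `tr = 1 + det` for `ι(r_w)` on inertia; `trace/det_eq_of_isTransportAlong`,
`IsWeilDeligneOfLadic.trace/det_eq_of_mem_inertia` and `WeilGroup.inertia_map_toAbsGalois` move it
to `ρ|_{Γ_{ℚ_w}}` on `absInertia`; Part F's `inertia_shape_of_local_trace_eq_one_add_det` concludes.
[cite: Hida2000, Thm. 3.26 (3)(a), pp. 152–153] [cite: CarayolASENS1986, Thm. (A)]
[cite: Skinner2009, (1) p. 242] -/
theorem inertia_of_level_of_localGlobal (hX : galoisRep_GL2_totallyReal_localGlobal)
    (hrec : ∀ {N : ℕ} [NeZero N] {k : ℤ} (g : CuspForm (Gamma1 N) k), 2 ≤ k → IsNewform1 g →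
      ∀ (hcpt : isCompact_glFiniteIntegralLevel 2 ℚ) (π : CuspidalAutomorphicRepData 2 ℚ hcpt),
        π.1.HasInfinityType (fun _ =>
          ({⟨(k : ℂ) - 1, 0, ⟨k - 1, by push_cast; ring⟩⟩, ⟨0, (k : ℂ) - 1, ⟨1 - k, by push_cast; ring⟩⟩} :
            Multiset ArchWeight)) →
        (∀ ℓ : ℕ, ℓ.Prime → ¬ ℓ ∣ N →
          ∀ w : HeightOneSpectrum (𝓞 ℚ), (ℓ : 𝓞 ℚ) ∈ w.asIdeal →
            ∃ α : Multiset ℂ, π.1.HasSatakeParamAt w α ∧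
              (α.map fun a => X - C a⁻¹).prod =
                X ^ 2 - C ((qExpansion 1 ⇑g).coeff ℓ) * X +
                  C ((nebentypus g (ℓ : ZMod N) : ℂ) * (ℓ : ℂ) ^ (k - 1))) →
        ∀ ℓ : ℕ, ℓ.Prime → ℓ ∣ N → padicValNat ℓ N = padicValNat ℓ (nebentypus g).conductor →
        ∀ w : HeightOneSpectrum (𝓞 ℚ), (ℓ : 𝓞 ℚ) ∈ w.asIdeal →
        ∀ (d : LocalLanglandsDatum (w.adicCompletion ℚ))
          (πv : SmoothIrrep (GL (Fin 2) (w.adicCompletion ℚ))),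
          π.1.HasLocalComponentAt w πv.ρ →
        ∀ (W : WeilDeligneRep (w.adicCompletion ℚ) ℂ (Fin 2 → ℂ)) (hW : W.IsFrobSemisimple),
          Quotient.mk (frobSemisimpleWDSetoid (w.adicCompletion ℚ) 2) ⟨W, hW⟩ =
            d.recGL 2 (IrrClass.mk πv) →
        ∀ u ∈ WeilGroup.inertia (w.adicCompletion ℚ),
          LinearMap.trace ℂ _ (W.ρ u) = 1 + LinearMap.det (W.ρ u)) :
    Hida2000_thm326_inertia_of_level := by
  intro N _ k g hk hg p _ ι ρ hρ hirr ℓ hℓ hℓp hℓN hcond w hw 𝔔 h𝔔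
  classical
  have hcpt : isCompact_glFiniteIntegralLevel 2 ℚ := isCompact_glFiniteIntegralLevel_holds 2 ℚ
  obtain ⟨π, hT, hSat, hAE⟩ := exists_cuspidalRepData_satakeFrobCompatibleAE g hk hg p ι ρ hρ hcpt
  have hLR := isLAlgebraic_of_hasInfinityType_weight (π := π) (by omega) hT
  -- Carayol's theorem (the named fact) at `(ℚ, π, p, ι, ρ)`
  obtain ⟨llc, hllc⟩ := hX ℚ inferInstance
  obtain ⟨-, hloc⟩ := hllc hcpt π hLR.1 hLR.2 p ι ρ hirr hAE
  obtain ⟨πv, rv, rC, hπv, hlad, -, hTr, hcls⟩ := hloc w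
  -- `w ∣ ℓ ≠ p`, so the Weil–Deligne representation at `w` is Grothendieck–Deligne's
  have hwℓ : natGenerator w = ℓ :=
    (Nat.prime_dvd_prime_iff_eq (prime_natGenerator w) hℓ).mp ((Rat.natCast_mem_asIdeal_iff w).mp hw)
  have hpw : ((p : ℕ) : 𝓞 ℚ) ∉ w.asIdeal := by
    rw [Rat.natCast_mem_asIdeal_iff, hwℓ]
    exact fun h => hℓp ((Nat.prime_dvd_prime_iff_eq hℓ Fact.out).mp h)
  have hWD : IsWeilDeligneOfLadic (ρ.toLocal w).toWeilGroupHom rv := hlad hpw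
  -- the Frobenius-semisimplification of `ι(r_w)` lies in `rec(π_w)`; read `hrec` on it
  obtain ⟨r', hr', hq⟩ := hcls
  have htr : ∀ u ∈ WeilGroup.inertia (w.adicCompletion ℚ),
      LinearMap.trace ℂ _ (rC.ρ u) = 1 + LinearMap.det (rC.ρ u) := by
    intro u hu
    rw [← hr'.2.1 u hu]
    exact hrec g hk hg hcpt π hT hSat ℓ hℓ hℓN hcond w hw (llc w) πv hπv r' hr'.isFrobSemisimple hq u hu
  -- move the identity to `ρ|_{Γ_{ℚ_w}}` on the inertia group and apply Part F
  refine inertia_shape_of_local_trace_eq_one_add_det g hk p ι ρ hρ hℓ hℓp hℓN hcond hw ?_ 𝔔 h𝔔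
  intro s hs
  have hs' : s ∈ (WeilGroup.inertia (w.adicCompletion ℚ)).map (WeilGroup.toAbsGalois _) := by
    rw [WeilGroup.inertia_map_toAbsGalois]
    exact hs
  obtain ⟨u, hu, rfl⟩ := Subgroup.mem_map.mp hs'
  have h1 := hWD.trace_eq_of_mem_inertia u hu
  have h2 := hWD.det_eq_of_mem_inertia u hu
  rw [FramedRep.toWeilGroupHom_apply] at h1 h2
  rw [FramedGaloisRep.toLocal_apply] at h1 h2 ⊢
  rw [h1, h2, ← linearMap_trace_eq_trace_toMatrix', LinearMap.det_toMatrix']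
  apply ι.injective
  have ht := trace_eq_of_isTransportAlong hTr u
  have hd := det_eq_of_isTransportAlong hTr u
  have h := htr u hu
  rw [ht, hd] at h
  rw [map_add, map_one]
  exact h

end LocalGlobal

end Literature.NumberTheory.EllipticCurves.Hida2000Thm326

end
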